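import Mathlib
import HarnessLib
import Literature.Computability.Complexity.CNF

/-!
# PneNP / OverlapGapAlgebra — `SearchHardWindow` (stmt-PneNP-2460): exact self-couplings of `F_k(n, m)`

Line `IdeaSketch_r2_k6` of crux stmt-PneNP-2460 (crux-ideate round 2, ideator 6; lead a1), the
complexity-free core. The route's literal-array model of random `k`-SAT is a uniformly random
`Φ : Fin m → Fin k → Fin n × Bool` (literal `(v, b)` true under `x` iff `x v = b`). Two maps of
this family are EXACTLY measure preserving (constant multiplicity) and satisfying assignments pull
back along them:

* **variable quotient** `Φ ↦ quot Φ := fun i j => ((finProdFinEquiv.symm (Φ i j).1).1, (Φ i j).2)`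
  from `F_k(n'·q, m)` onto `F_k(n', m)` (merge the variables in blocks of `q`, `v ↦ v / q`,
  `shwQ_coe_quotVar`): every fibre has `q^{mk}` points (`shwQ_card_filter_quot`,
  `shwQ_card_inst_quot`), and the block-constant lift `v ↦ x' (v / q)` of `x'` satisfies `Φ` iff
  `x'` satisfies `quot Φ` (definitionally);
* **first-literal truncation** `Φ ↦ fun i => Fin.tail (Φ i)` from `F_{k+1}(n, m)` onto `F_k(n, m)`:
  every fibre has `(2n)^m` points (`shwQ_card_filter_trunc`, `shwQ_card_inst_trunc`), and
  `x ⊨ tail Φ → x ⊨ Φ`.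

Consequences, for ARBITRARY maps (no complexity): `shwQ_successRatio_lift` (a map `g'` on
`F_k(n', m)` and its lift to `F_k(n'q, m)` have equal success ratios), `shwQ_successRatio_trunc`
(`g ∘ tail` on `F_{k+1}(n, m)` succeeds at least as often as `g` on `F_k(n, m)`), and the WORD-LEVEL
forms `shwQ_wordRatio_quot` / `shwQ_wordRatio_trunc` for word functions `f, f'` related by the
quotient resp. truncation transcoding identities (the crux's input/output conventions verbatim:
input `encodingCNF.encode (List.ofFn …)`, output word read as `v ↦ y.getD v false`). The
polynomial-time transcoders themselves are the landed bricks `stub_requotPolyTime`,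
`stub_stretchPolyTime`, `stub_retruncPolyTime`; the resulting DETERMINISTIC monotonicity of the
crux's hardness conjunct (`α ↦ q α`, `k + 1 ↦ k`) is `OverlapGapAlgebraSearchHardWindowDensityMonotone.lean`.

No definitions are introduced (statements are inline in the crux's vocabulary).
Lead prover-line-stmt-PneNP-2460-a1-0, 2026-08-16.
-/

namespace Summit.PneNP.PneNP.Theorems

set_option linter.dupNamespace false -- `Summit.PneNP.PneNP.…`: summit = sub-problem (D-0017)

open Finset Literature.Computability.Complexity
open scoped Classical

/-! ## Counting along a projection -/

/-- Counting along a first projection: `#{(a, b) | P a} = #{a | P a} · |β|`. [folklore] -/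
theorem shwQ_card_filter_fst {α β : Type*} [Fintype α] [Fintype β] (P : α → Prop) [DecidablePred P] :
    ((univ : Finset (α × β)).filter fun p => P p.1).card = (univ.filter P).card * Fintype.card β := by
  have h : ((univ : Finset (α × β)).filter fun p => P p.1) = (univ.filter P) ×ˢ (univ : Finset β) := by
    ext ⟨a, b⟩
    simp only [Finset.mem_filter, Finset.mem_univ, true_and, Finset.mem_product, and_true]
  rw [h, Finset.card_product, Finset.card_univ]

/-! ## Coupling 1: the variable quotient `v ↦ v / q` (`F_k(n'q, m) → F_k(n', m)`, density `× q`) -/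

/-- The quotient variable of `v : Fin (n' q)` is `v / q` (as a natural number). [folklore] -/
theorem shwQ_coe_quotVar {n' q : ℕ} (v : Fin (n' * q)) :
    ((finProdFinEquiv.symm v).1 : ℕ) = (v : ℕ) / q := by
  simp [finProdFinEquiv_symm_apply, Fin.coe_divNat]

/-- **The quotient coupling**: an instance on `n'·q` variables IS the pair (its quotient instance,
its array of block offsets). [folklore] -/
theorem shwQ_quotEquiv (m k n' q : ℕ) :
    ∃ e : (Fin m → Fin k → Fin (n' * q) × Bool) ≃
        (Fin m → Fin k → Fin n' × Bool) × (Fin m → Fin k → Fin q),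
      ∀ Φ, (e Φ).1 = fun i j => ((finProdFinEquiv.symm (Φ i j).1).1, (Φ i j).2) := by
  refine ⟨{ toFun := fun Φ => (fun i j => ((finProdFinEquiv.symm (Φ i j).1).1, (Φ i j).2),
              fun i j => (finProdFinEquiv.symm (Φ i j).1).2)
            invFun := fun p i j => (finProdFinEquiv ((p.1 i j).1, p.2 i j), (p.1 i j).2)
            left_inv := fun Φ => ?_
            right_inv := fun p => ?_ }, fun Φ => rfl⟩
  · funext i j
    simp only [Prod.mk.eta, Equiv.apply_symm_apply]
  · obtain ⟨Φ', ρ⟩ := p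
    simp only [Equiv.symm_apply_apply, Prod.mk.eta]

/-- **Exact multiplicity `q^{mk}`**: the number of instances on `n'·q` variables whose quotient
satisfies a property `P` is `#{P} · q^{mk}`. [folklore] -/
theorem shwQ_card_filter_quot {m k n' q : ℕ} (P : (Fin m → Fin k → Fin n' × Bool) → Prop)
    [DecidablePred P] :
    ((univ : Finset (Fin m → Fin k → Fin (n' * q) × Bool)).filter fun Φ =>
        P (fun i j => ((finProdFinEquiv.symm (Φ i j).1).1, (Φ i j).2))).card
      = (univ.filter P).card * Fintype.card (Fin m → Fin k → Fin q) := by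
  obtain ⟨e, he⟩ := shwQ_quotEquiv m k n' q
  rw [← shwQ_card_filter_fst P]
  refine Finset.card_equiv e fun Φ => ?_
  simp only [Finset.mem_filter, Finset.mem_univ, true_and, he]

/-- Size of the instance space along the quotient: `#Ω(n'q) = #Ω(n') · q^{mk}`. [folklore] -/
theorem shwQ_card_inst_quot (m k n' q : ℕ) :
    Fintype.card (Fin m → Fin k → Fin (n' * q) × Bool)
      = Fintype.card (Fin m → Fin k → Fin n' × Bool) * Fintype.card (Fin m → Fin k → Fin q) := by
  obtain ⟨e, -⟩ := shwQ_quotEquiv m k n' q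
  rw [Fintype.card_congr e, Fintype.card_prod]

/-- The offset space is nonempty for `q ≥ 1` (as a real inequality). [folklore] -/
theorem shwQ_card_offsets_pos (m k : ℕ) {q : ℕ} (hq : 0 < q) :
    (0 : ℝ) < Fintype.card (Fin m → Fin k → Fin q) := by
  have : Nonempty (Fin m → Fin k → Fin q) := ⟨fun _ _ => ⟨0, hq⟩⟩
  exact_mod_cast Fintype.card_pos

/-- **Transport of a success ratio along the quotient (pull-back form).** For any property `P` of
instances on `n'` variables, the density of `{Φ | P (quot Φ)}` in `F_k(n'q, m)` equals the
density of `P` in `F_k(n', m)` (`q ≥ 1`). [folklore] -/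
theorem shwQ_ratio_quot {m k n' q : ℕ} (hq : 0 < q) (P : (Fin m → Fin k → Fin n' × Bool) → Prop)
    [DecidablePred P] :
    (((univ : Finset (Fin m → Fin k → Fin (n' * q) × Bool)).filter fun Φ =>
        P (fun i j => ((finProdFinEquiv.symm (Φ i j).1).1, (Φ i j).2))).card : ℝ)
        / Fintype.card (Fin m → Fin k → Fin (n' * q) × Bool)
      = ((univ.filter P).card : ℝ) / Fintype.card (Fin m → Fin k → Fin n' × Bool) := by
  rw [shwQ_card_filter_quot P, shwQ_card_inst_quot]
  push_cast
  rw [mul_div_mul_right _ _ (shwQ_card_offsets_pos m k hq).ne']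

/-- **Transport of success along the quotient, for an arbitrary map.** For ANY map `g'` from
instances on `n'` variables to assignments, the lifted map `Φ ↦ (v ↦ g' (quot Φ) (v / q))` on
`F_k(n'·q, m)` has exactly the same success ratio as `g'` on `F_k(n', m)` — a solver at density
`m / n'` yields one at density `m / (n' q)`… read contrapositively, hardness at density `α`
transports to density `q α`, with no padding, coins or advice. [folklore] -/
theorem shwQ_successRatio_lift {m k n' q : ℕ} (hq : 0 < q)
    (g' : (Fin m → Fin k → Fin n' × Bool) → (Fin n' → Bool)) :
    (((univ : Finset (Fin m → Fin k → Fin (n' * q) × Bool)).filter fun Φ => ∀ i, ∃ j,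
        g' (fun i j => ((finProdFinEquiv.symm (Φ i j).1).1, (Φ i j).2))
          (finProdFinEquiv.symm (Φ i j).1).1 = (Φ i j).2).card : ℝ)
        / Fintype.card (Fin m → Fin k → Fin (n' * q) × Bool)
      = ((univ.filter fun Φ' : Fin m → Fin k → Fin n' × Bool =>
          ∀ i, ∃ j, g' Φ' (Φ' i j).1 = (Φ' i j).2).card : ℝ)
        / Fintype.card (Fin m → Fin k → Fin n' × Bool) :=
  shwQ_ratio_quot hq (fun Φ' : Fin m → Fin k → Fin n' × Bool => ∀ i, ∃ j, g' Φ' (Φ' i j).1 = (Φ' i j).2)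

/-- The clause list of the quotient instance is the literal map `(v, b) ↦ (v / q, b)` of the
clause list of the instance (the crux's input convention `List.ofFn`). [folklore] -/
theorem shwQ_clauses_quot {m k n' q : ℕ} (Φ : Fin m → Fin k → Fin (n' * q) × Bool) :
    (List.ofFn fun a => List.ofFn fun b =>
        ((((finProdFinEquiv.symm (Φ a b).1).1 : Fin n') : ℕ), (Φ a b).2)) =
      (List.ofFn fun a => List.ofFn fun b => (((Φ a b).1 : ℕ), (Φ a b).2)).map
        fun c => c.map fun l => (l.1 / q, l.2) := by
  rw [List.map_ofFn]
  refine congrArg List.ofFn (funext fun a => ?_)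
  rw [Function.comp_apply, List.map_ofFn]
  refine congrArg List.ofFn (funext fun b => ?_)
  simp only [Function.comp_apply, shwQ_coe_quotVar]

/-- **Word-level transport along the quotient.** If the word functions `f` (for `n'q` variables)
and `f'` (for `n'` variables) are related by the quotient transcoding identity — `f`'s answer
table on the code of a clause list `L` is the `q`-fold stretch of `f'`'s table on the code of `L`
with every literal `(v, b)` replaced by `(v / q, b)` — then `f` on `F_k(n'q, m)` and `f'` on
`F_k(n', m)` have EQUAL success ratios (crux conventions verbatim). [folklore] -/
theorem shwQ_wordRatio_quot {q : ℕ} (hq : 0 < q) {f f' : List Bool → List Bool}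
    (hff' : ∀ (L : List (List (ℕ × Bool))) (v : ℕ), (f (encodingCNF.encode L)).getD v false =
      (f' (encodingCNF.encode (L.map fun c => c.map fun l => (l.1 / q, l.2)))).getD (v / q) false)
    (m k n' : ℕ) :
    ((univ.filter fun Φ : Fin m → Fin k → Fin (n' * q) × Bool => ∀ i, ∃ j,
        (f (encodingCNF.encode (List.ofFn fun a => List.ofFn fun b =>
          (((Φ a b).1 : ℕ), (Φ a b).2)))).getD (Φ i j).1 false = (Φ i j).2).card : ℝ) /
        Fintype.card (Fin m → Fin k → Fin (n' * q) × Bool)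
      = ((univ.filter fun Φ' : Fin m → Fin k → Fin n' × Bool => ∀ i, ∃ j,
          (f' (encodingCNF.encode (List.ofFn fun a => List.ofFn fun b =>
            (((Φ' a b).1 : ℕ), (Φ' a b).2)))).getD (Φ' i j).1 false = (Φ' i j).2).card : ℝ) /
          Fintype.card (Fin m → Fin k → Fin n' × Bool) := by
  rw [← shwQ_ratio_quot hq (fun Φ' : Fin m → Fin k → Fin n' × Bool => ∀ i, ∃ j,
    (f' (encodingCNF.encode (List.ofFn fun a => List.ofFn fun b =>
      (((Φ' a b).1 : ℕ), (Φ' a b).2)))).getD (Φ' i j).1 false = (Φ' i j).2)]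
  congr 1
  refine congrArg _ (congrArg Finset.card (Finset.filter_congr fun Φ _ => ?_))
  refine forall_congr' fun i => exists_congr fun j => ?_
  rw [hff', ← shwQ_clauses_quot Φ, shwQ_coe_quotVar]

/-! ## Coupling 2: first-literal truncation (`F_{k+1}(n, m) → F_k(n, m)`) -/

/-- **The truncation coupling**: a `(k+1)`-instance IS the pair (its truncation, its array of
first literals). [folklore] -/
theorem shwQ_truncEquiv (m k n : ℕ) :
    ∃ e : (Fin m → Fin (k + 1) → Fin n × Bool) ≃
        (Fin m → Fin k → Fin n × Bool) × (Fin m → Fin n × Bool),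
      ∀ Φ, (e Φ).1 = fun i => Fin.tail (Φ i) := by
  refine ⟨{ toFun := fun Φ => (fun i => Fin.tail (Φ i), fun i => Φ i 0)
            invFun := fun p i => Fin.cons (p.2 i) (p.1 i)
            left_inv := fun Φ => ?_
            right_inv := fun p => ?_ }, fun Φ => rfl⟩
  · funext i
    exact Fin.cons_self_tail (Φ i)
  · obtain ⟨Φ', h⟩ := p
    refine Prod.ext (funext fun i => ?_) (funext fun i => ?_)
    · show Fin.tail (Fin.cons (h i) (Φ' i) : Fin (k + 1) → Fin n × Bool) = Φ' i
      rw [Fin.tail_cons]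
    · show (Fin.cons (h i) (Φ' i) : Fin (k + 1) → Fin n × Bool) 0 = h i
      rw [Fin.cons_zero]

/-- **Exact multiplicity `(2n)^m`**: the number of `(k+1)`-instances whose truncation satisfies `P`
is `#{P} · (2n)^m`. [folklore] -/
theorem shwQ_card_filter_trunc {m k n : ℕ} (P : (Fin m → Fin k → Fin n × Bool) → Prop)
    [DecidablePred P] :
    ((univ : Finset (Fin m → Fin (k + 1) → Fin n × Bool)).filter fun Φ =>
        P (fun i => Fin.tail (Φ i))).card
      = (univ.filter P).card * Fintype.card (Fin m → Fin n × Bool) := by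
  obtain ⟨e, he⟩ := shwQ_truncEquiv m k n
  rw [← shwQ_card_filter_fst P]
  refine Finset.card_equiv e fun Φ => ?_
  simp only [Finset.mem_filter, Finset.mem_univ, true_and, he]

/-- Size of the instance space along truncation: `#Ω_{k+1} = #Ω_k · (2n)^m`. [folklore] -/
theorem shwQ_card_inst_trunc (m k n : ℕ) :
    Fintype.card (Fin m → Fin (k + 1) → Fin n × Bool)
      = Fintype.card (Fin m → Fin k → Fin n × Bool) * Fintype.card (Fin m → Fin n × Bool) := by
  obtain ⟨e, -⟩ := shwQ_truncEquiv m k n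
  rw [Fintype.card_congr e, Fintype.card_prod]

/-- The first-literal space is nonempty for `n ≥ 1` (as a real inequality). [folklore] -/
theorem shwQ_card_heads_pos (m : ℕ) {n : ℕ} (hn : 0 < n) :
    (0 : ℝ) < Fintype.card (Fin m → Fin n × Bool) := by
  have : Nonempty (Fin m → Fin n × Bool) := ⟨fun _ => (⟨0, hn⟩, true)⟩
  exact_mod_cast Fintype.card_pos

/-- **Transport of a success ratio along truncation (pull-back form).** If `Q Φ` holds whenever
`P (tail Φ)` does, then the density of `P` in `F_k(n, m)` is at most the density of `Q` in
`F_{k+1}(n, m)` (`n ≥ 1`). [folklore] -/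
theorem shwQ_ratio_trunc {m k n : ℕ} (hn : 0 < n) (P : (Fin m → Fin k → Fin n × Bool) → Prop)
    [DecidablePred P] (Q : (Fin m → Fin (k + 1) → Fin n × Bool) → Prop) [DecidablePred Q]
    (hPQ : ∀ Φ, P (fun i => Fin.tail (Φ i)) → Q Φ) :
    ((univ.filter P).card : ℝ) / Fintype.card (Fin m → Fin k → Fin n × Bool)
      ≤ ((univ.filter Q).card : ℝ) / Fintype.card (Fin m → Fin (k + 1) → Fin n × Bool) := by
  have hsub : ((univ : Finset (Fin m → Fin (k + 1) → Fin n × Bool)).filter fun Φ =>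
      P (fun i => Fin.tail (Φ i))) ⊆ univ.filter Q := by
    intro Φ hΦ
    simp only [Finset.mem_filter, Finset.mem_univ, true_and] at hΦ ⊢
    exact hPQ Φ hΦ
  have hle := Finset.card_le_card hsub
  rw [shwQ_card_filter_trunc P] at hle
  have hc := shwQ_card_heads_pos m hn
  rw [shwQ_card_inst_trunc]
  push_cast
  calc ((univ.filter P).card : ℝ) / Fintype.card (Fin m → Fin k → Fin n × Bool)
      = ((univ.filter P).card : ℝ) * Fintype.card (Fin m → Fin n × Bool)
          / (Fintype.card (Fin m → Fin k → Fin n × Bool) * Fintype.card (Fin m → Fin n × Bool)) := by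
        rw [mul_div_mul_right _ _ hc.ne']
    _ ≤ _ := by
        gcongr
        exact_mod_cast hle

/-- **Transport of success along truncation, for an arbitrary map.** For ANY map `g` from
`k`-instances to assignments, `g ∘ tail` on `F_{k+1}(n, m)` succeeds at least as often as `g` on
`F_k(n, m)` (`n ≥ 1`): a satisfying assignment of the truncated clauses satisfies the clauses.
[folklore] -/
theorem shwQ_successRatio_trunc {m k n : ℕ} (hn : 0 < n)
    (g : (Fin m → Fin k → Fin n × Bool) → (Fin n → Bool)) :
    ((univ.filter fun Φ' : Fin m → Fin k → Fin n × Bool =>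
        ∀ i, ∃ j, g Φ' (Φ' i j).1 = (Φ' i j).2).card : ℝ) / Fintype.card (Fin m → Fin k → Fin n × Bool)
      ≤ (((univ : Finset (Fin m → Fin (k + 1) → Fin n × Bool)).filter fun Φ =>
          ∀ i, ∃ j, g (fun i => Fin.tail (Φ i)) (Φ i j).1 = (Φ i j).2).card : ℝ)
          / Fintype.card (Fin m → Fin (k + 1) → Fin n × Bool) :=
  shwQ_ratio_trunc hn (fun Φ' : Fin m → Fin k → Fin n × Bool => ∀ i, ∃ j, g Φ' (Φ' i j).1 = (Φ' i j).2)
    _ fun _ h i => let ⟨j, hj⟩ := h i; ⟨j.succ, hj⟩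

/-- The clause list of the truncated instance is `List.tail` of every clause of the clause list
of the instance (the crux's input convention `List.ofFn`). [folklore] -/
theorem shwQ_clauses_trunc {m k n : ℕ} (Φ : Fin m → Fin (k + 1) → Fin n × Bool) :
    (List.ofFn fun a => List.ofFn fun b => (((Fin.tail (Φ a) b).1 : ℕ), (Fin.tail (Φ a) b).2)) =
      (List.ofFn fun a => List.ofFn fun b => (((Φ a b).1 : ℕ), (Φ a b).2)).map List.tail := by
  rw [List.map_ofFn]
  refine congrArg List.ofFn (funext fun a => ?_)
  rw [Function.comp_apply, List.ofFn_succ, List.tail_cons]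
  rfl

/-- **Word-level transport along truncation.** If the word functions `f` (width `k + 1`) and `f'`
(width `k`) satisfy `f (code L) = f' (code (L.map List.tail))`, then `f` on `F_{k+1}(n, m)`
succeeds at least as often as `f'` on `F_k(n, m)` (`n ≥ 1`; crux conventions verbatim). [folklore] -/
theorem shwQ_wordRatio_trunc {f f' : List Bool → List Bool}
    (hff' : ∀ L : List (List (ℕ × Bool)),
      f (encodingCNF.encode L) = f' (encodingCNF.encode (L.map List.tail)))
    (m k : ℕ) {n : ℕ} (hn : 0 < n) :
    ((univ.filter fun Φ' : Fin m → Fin k → Fin n × Bool => ∀ i, ∃ j,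
        (f' (encodingCNF.encode (List.ofFn fun a => List.ofFn fun b =>
          (((Φ' a b).1 : ℕ), (Φ' a b).2)))).getD (Φ' i j).1 false = (Φ' i j).2).card : ℝ) /
        Fintype.card (Fin m → Fin k → Fin n × Bool)
      ≤ ((univ.filter fun Φ : Fin m → Fin (k + 1) → Fin n × Bool => ∀ i, ∃ j,
          (f (encodingCNF.encode (List.ofFn fun a => List.ofFn fun b =>
            (((Φ a b).1 : ℕ), (Φ a b).2)))).getD (Φ i j).1 false = (Φ i j).2).card : ℝ) /
          Fintype.card (Fin m → Fin (k + 1) → Fin n × Bool) := by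
  refine shwQ_ratio_trunc hn (fun Φ' : Fin m → Fin k → Fin n × Bool => ∀ i, ∃ j,
    (f' (encodingCNF.encode (List.ofFn fun a => List.ofFn fun b =>
      (((Φ' a b).1 : ℕ), (Φ' a b).2)))).getD (Φ' i j).1 false = (Φ' i j).2) _ fun Φ h i => ?_
  obtain ⟨j, hj⟩ := h i
  refine ⟨j.succ, ?_⟩
  rw [hff', ← shwQ_clauses_trunc Φ]
  exact hj

end Summit.PneNP.PneNP.Theorems
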